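import Literature.Probability.MarkovChains.PeskunOrdering
import HarnessLib

/-!
# RANDOMLY ALTERNATING REVERSIBLE SAMPLERS IS NEVER WORSE THAN THE HARMONIC MEAN OF RUNNING EACH ALONE: `v(f, Σ αᵢPᵢ) + var_π f ≤ 1/Σᵢ αᵢ/(v(f, Pᵢ) + var_π f)` (finite state space, Kemeny–Snell asymptotic variance)

HONEST FRAMING: exact (Metropolis-corrected) sampling algorithms for lattice gauge theory;
figures of merit are autocorrelation/cost numbers at stated couplings and volumes; no
continuum-physics claim.  (SCALAR calibration rung S0-A: not a gauge result.)

Venture `LatticeQCDFlow` (cell pub-lqcd), topic `Exactness`; FANOUT row 2 (`s0-phi4`).  NEW WORK of the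
cell, in the tree's FINITE-STATE vocabulary (`Literature.Probability.MarkovChains.PeskunOrdering`:
`asympVar f π P = f(2BZ − B − BA)fᵀ`, Peskun 1973 eq. (4); `fundamentalMatrix`; the Bellman /
Caracciolo–Pelissetto–Sokal variational formula `variational_le` / `variational_eq`, Andrieu–Vihola
2016 Lemma 16).  Several `π`-reversible irreducible kernels `P₁, …, P_N` on a finite state space (a flow
sampler, an HMC update, a heat bath, … — NO positivity required) and positive weights `αᵢ`, `Σ αᵢ = 1`;
the RANDOM ALTERNATION `P = Σ αᵢ Pᵢ` (pick sampler `i` with probability `αᵢ` at each step).  For every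
observable `f` with `var_π f > 0`:

  **`v(f, Σ αᵢPᵢ) + var_π f ≤ 1 / Σᵢ αᵢ/(v(f, Pᵢ) + var_π f)`**

— `(v + var)/(2 var) = τ_int`, so `τ_int^{mix}(f) ≤ (Σ αᵢ/τ_int^{Pᵢ}(f))⁻¹`, the weighted HARMONIC mean
of the components' integrated autocorrelation times, hence at most their arithmetic mean.  Mechanism:
`⟨f̄, Z f̄⟩_π = sup_u [2⟨f̄,u⟩ − 𝓔_P(u)]` is a supremum of functions AFFINE in `P` (`𝓔_{ΣαᵢPᵢ} = Σαᵢ𝓔_{Pᵢ}`),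
and the homogeneous form of the supremum turns the average of the forms into a harmonic mean of the
suprema (the operator-convexity of `A ↦ A⁻¹`, NAMED, never invoked).  Companion of the flow-arm file
`FlowSamplerMixtureHarmonicMean` (mixture of PROPOSALS inside one Metropolis step; by Tierney 1998
Prop. 5 — tree `MixtureProposalPeskun.Liu2001_thm_13_3_4_asympVar` — that is never worse than the
alternation treated here).  Nothing is cited as a fact; the Literature file carries its citations.

## What is proved (namespace `Summit.Ventures.LatticeQCDFlow.Exactness`, finite `X`)

* (`P = fun x y => Σ αᵢ Pᵢ x y`) `kernelMix_isRowStochastic`, `kernelMix_detailedBalance`, `kernelMix_isIrreducible` (entrywise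
  `Σ αⱼPⱼ ≥ αᵢPᵢ` and powers), `dirichletForm_kernelMix` (`𝓔_{ΣαP} = Σ α 𝓔_P`);
* `sq_div_le_of_variational` — `V > 0`, `E ≥ 0`, `∀ c, 2cb − c²E ≤ V` ⇒ `b²/V ≤ E`;
* `piInner_fundamental_pos` — `⟨f̄, Z f̄⟩_π > 0` for non-constant `f` (irreducible reversible `P`);
* **`kernelMix_piInner_fundamental_le_harmonicMean`** — `⟨f̄, Z_mix f̄⟩ ≤ 1/Σ αᵢ/⟨f̄, Zᵢ f̄⟩`;
* **`kernelMix_asympVar_le_harmonicMean`** — THE THEOREM above.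

NOT CLAIMED: general state spaces (the flow-arm analogue for independence samplers is
`FlowSamplerMixtureHarmonicMean`); cost accounting; equality cases.
-/

namespace Summit.Ventures.LatticeQCDFlow.Exactness

open Finset Matrix Literature.Probability.MarkovChains

variable {X : Type*} [Fintype X] [DecidableEq X] {ι : Type*} [Fintype ι]

/-! ## §1 The alternation kernel `Σ αᵢ Pᵢ` -/

omit [DecidableEq X] in
/-- `Σ αᵢ Pᵢ` is row-stochastic (`αᵢ ≥ 0`, `Σ αᵢ = 1`). -/
theorem kernelMix_isRowStochastic {α : ι → ℝ} {P : ι → Matrix X X ℝ} (hα : ∀ i, 0 ≤ α i)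
    (hα1 : ∑ i, α i = 1) (hP : ∀ i, IsRowStochastic (P i)) : IsRowStochastic (fun x y => ∑ i, α i * P i x y) := by
  refine ⟨fun x y => sum_nonneg fun i _ => mul_nonneg (hα i) ((hP i).1 x y), fun x => ?_⟩
  show ∑ y, ∑ i, α i * P i x y = 1
  rw [Finset.sum_comm]
  have e : ∀ i, ∑ y, α i * P i x y = α i := fun i => by rw [← Finset.mul_sum, (hP i).2 x, mul_one]
  simp only [e, hα1]

omit [Fintype X] [DecidableEq X] in
/-- `Σ αᵢ Pᵢ` is `π`-reversible when every `Pᵢ` is. -/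
theorem kernelMix_detailedBalance {α : ι → ℝ} {P : ι → Matrix X X ℝ} {π : X → ℝ}
    (hDB : ∀ i, DetailedBalance π (P i)) : DetailedBalance π (fun x y => ∑ i, α i * P i x y) := by
  intro x y
  show π x * ∑ i, α i * P i x y = π y * ∑ i, α i * P i y x
  rw [Finset.mul_sum, Finset.mul_sum]
  refine Finset.sum_congr rfl fun i _ => ?_
  have h := hDB i x y
  calc π x * (α i * P i x y) = α i * (π x * P i x y) := by ring
    _ = α i * (π y * P i y x) := by rw [h]
    _ = π y * (α i * P i y x) := by ring

omit [DecidableEq X] in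
/-- The Dirichlet form is linear in the kernel: `𝓔_{Σ αᵢPᵢ}(u) = Σ αᵢ 𝓔_{Pᵢ}(u)`. -/
theorem dirichletForm_kernelMix (α : ι → ℝ) (P : ι → Matrix X X ℝ) (π u : X → ℝ) :
    dirichletForm π (fun x y => ∑ i, α i * P i x y) u = ∑ i, α i * dirichletForm π (P i) u := by
  unfold dirichletForm
  have e : ∀ x y, π x * (∑ i, α i * P i x y) * (u x - u y) ^ 2
      = ∑ i, α i * (π x * P i x y * (u x - u y) ^ 2) := fun x y => by
    rw [Finset.mul_sum, Finset.sum_mul]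
    exact Finset.sum_congr rfl fun i _ => by ring
  have e2 : ∀ x, ∑ y, π x * (∑ i, α i * P i x y) * (u x - u y) ^ 2
      = ∑ i, α i * ∑ y, π x * P i x y * (u x - u y) ^ 2 := fun x => by
    simp only [e]
    rw [Finset.sum_comm]
    exact Finset.sum_congr rfl fun i _ => by rw [Finset.mul_sum]
  simp only [e2]
  rw [Finset.sum_comm, Finset.mul_sum]
  refine Finset.sum_congr rfl fun i _ => ?_
  rw [← Finset.mul_sum]
  ring

/-- Entrywise domination propagates to powers of nonnegative matrices:
`c Q ≤ P`, `c ≥ 0`, `Q ≥ 0`, `P ≥ 0` ⇒ `cⁿ Qⁿ ≤ Pⁿ` entrywise. -/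
theorem pow_apply_ge_of_entry_ge {P Q : Matrix X X ℝ} {c : ℝ} (hc : 0 ≤ c) (hQ : ∀ x y, 0 ≤ Q x y)
    (hP : ∀ x y, 0 ≤ P x y) (hle : ∀ x y, c * Q x y ≤ P x y) (n : ℕ) :
    (∀ x y, 0 ≤ (P ^ n) x y) ∧ ∀ x y, c ^ n * (Q ^ n) x y ≤ (P ^ n) x y := by
  classical
  induction n with
  | zero =>
    refine ⟨fun x y => ?_, fun x y => by simp⟩
    simp only [pow_zero, Matrix.one_apply]
    split_ifs <;> norm_num
  | succ n ih =>
    obtain ⟨ih0, ih1⟩ := ih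
    refine ⟨fun x y => ?_, fun x y => ?_⟩
    · rw [pow_succ, Matrix.mul_apply]
      exact sum_nonneg fun z _ => mul_nonneg (ih0 x z) (hP z y)
    · rw [pow_succ P, pow_succ Q, pow_succ c, Matrix.mul_apply, Matrix.mul_apply, Finset.mul_sum]
      refine Finset.sum_le_sum fun z _ => ?_
      calc c ^ n * c * ((Q ^ n) x z * Q z y) = (c ^ n * (Q ^ n) x z) * (c * Q z y) := by ring
        _ ≤ (P ^ n) x z * P z y :=
            mul_le_mul (ih1 x z) (hle z y) (mul_nonneg hc (hQ z y)) (ih0 x z)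

/-- `Σ αᵢ Pᵢ` is irreducible as soon as ONE component with positive weight is. -/
theorem kernelMix_isIrreducible {α : ι → ℝ} {P : ι → Matrix X X ℝ} (hα : ∀ i, 0 ≤ α i)
    (hP : ∀ i, IsRowStochastic (P i)) {i₀ : ι} (hi₀ : 0 < α i₀)
    (hirr : Literature.Probability.MarkovChains.IsIrreducible (P i₀)) :
    Literature.Probability.MarkovChains.IsIrreducible (fun x y => ∑ i, α i * P i x y) := by
  intro x y
  obtain ⟨n, hn⟩ := hirr x y
  refine ⟨n, ?_⟩
  have hle : ∀ x y, α i₀ * P i₀ x y ≤ (fun x y => ∑ i, α i * P i x y) x y := fun x y =>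
    Finset.single_le_sum (f := fun i => α i * P i x y)
      (fun i _ => mul_nonneg (hα i) ((hP i).1 x y)) (Finset.mem_univ i₀)
  have hmix0 : ∀ x y, 0 ≤ (fun x y => ∑ i, α i * P i x y) x y := fun x y =>
    sum_nonneg fun i _ => mul_nonneg (hα i) ((hP i).1 x y)
  obtain ⟨-, h⟩ := pow_apply_ge_of_entry_ge hi₀.le (hP i₀).1 hmix0 hle n
  exact lt_of_lt_of_le (mul_pos (pow_pos hi₀ n) hn) (h x y)

/-! ## §2 Two scalar lemmas from the variational formula -/

/-- The homogeneous form of a variational bound: `V > 0`, `E ≥ 0`, `2cb − c²E ≤ V` for all real `c`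
⇒ `b²/V ≤ E`. -/
theorem sq_div_le_of_variational {V E b : ℝ} (hV : 0 < V) (hE : 0 ≤ E)
    (h : ∀ c : ℝ, 2 * c * b - c ^ 2 * E ≤ V) : b ^ 2 / V ≤ E := by
  rcases eq_or_lt_of_le hE with hE0 | hEpos
  · -- `E = 0`: then `b = 0`
    rw [← hE0]
    have hb : b = 0 := by
      by_contra hb
      have h1 := h (V / b)
      rw [← hE0] at h1
      have : 2 * (V / b) * b = 2 * V := by field_simp
      rw [this] at h1
      linarith
    rw [hb]
    simp
  · have h1 := h (b / E)
    have e : 2 * (b / E) * b - (b / E) ^ 2 * E = b ^ 2 / E := by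
      field_simp
      ring
    rw [e] at h1
    rw [div_le_iff₀ hV]
    rw [div_le_iff₀ hEpos] at h1
    linarith

/-- `H > 0` ⇒ `2b − b²H ≤ 1/H` (`(bH − 1)² ≥ 0`). -/
theorem two_mul_sub_sq_mul_le_inv {H b : ℝ} (hH : 0 < H) : 2 * b - b ^ 2 * H ≤ 1 / H := by
  rw [le_div_iff₀ hH]
  nlinarith [sq_nonneg (b * H - 1)]

/-! ## §3 The harmonic-mean bound -/

section Main

variable {π : X → ℝ}

/-- **`⟨f̄, Z f̄⟩_π > 0` for a non-constant observable** under an irreducible `π`-reversible kernel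
(from `variational_le` with trial vectors `c·f̄`). -/
theorem piInner_fundamental_pos (hπ : ∀ x, 0 < π x) (hπ1 : ∑ x, π x = 1) {P : Matrix X X ℝ}
    (hP : IsRowStochastic P) (hDB : DetailedBalance π P)
    (hirr : Literature.Probability.MarkovChains.IsIrreducible P) {g : X → ℝ}
    (hg : ∑ y, π y * g y = 0) (hg0 : 0 < piInner π g g) :
    0 < piInner π g (fundamentalMatrix π P *ᵥ g) := by
  have hst := hDB.isStationary hP.2
  have hK := isUnit_fundamentalInv hπ1 hP hst hirr
  set V := piInner π g (fundamentalMatrix π P *ᵥ g) with hV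
  set E := dirichletForm π P g with hE
  have hE0 : 0 ≤ E := dirichletForm_nonneg (fun x => (hπ x).le) hP.1 g
  have hvar : ∀ c : ℝ, 2 * c * piInner π g g - c ^ 2 * E ≤ V := fun c => by
    have h := variational_le hπ hπ1 hP hDB hK hg (c • g)
    have e1 : piInner π g (c • g) = c * piInner π g g := by
      unfold piInner
      rw [Finset.mul_sum]
      exact Finset.sum_congr rfl fun x _ => by simp [Pi.smul_apply, smul_eq_mul]; ring
    have e2 : dirichletForm π P (c • g) = c ^ 2 * E := by
      unfold dirichletForm
      rw [hE]
      unfold dirichletForm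
      rw [Finset.mul_sum, Finset.mul_sum, Finset.mul_sum]
      refine Finset.sum_congr rfl fun x _ => ?_
      rw [Finset.mul_sum, Finset.mul_sum, Finset.mul_sum]
      exact Finset.sum_congr rfl fun y _ => by simp [Pi.smul_apply, smul_eq_mul]; ring
    rw [e1, e2] at h
    linarith
  rcases eq_or_lt_of_le hE0 with hEz | hEpos
  · -- `E = 0` is impossible for `g ≠ 0`: the bound `2c‖g‖² ≤ V` would hold for every `c`
    have h := hvar ((V + 1) / (2 * piInner π g g))
    rw [← hEz, mul_zero, sub_zero] at h
    have e : 2 * ((V + 1) / (2 * piInner π g g)) * piInner π g g = V + 1 := by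
      field_simp
    rw [e] at h
    linarith
  · have h := hvar (piInner π g g / E)
    have e : 2 * (piInner π g g / E) * piInner π g g - (piInner π g g / E) ^ 2 * E
        = piInner π g g ^ 2 / E := by
      field_simp
      ring
    rw [e] at h
    exact lt_of_lt_of_le (div_pos (pow_pos hg0 2) hEpos) h

/-- **`⟨f̄, Z_mix f̄⟩ ≤ 1/Σᵢ αᵢ/⟨f̄, Zᵢ f̄⟩`** for the alternation `Σ αᵢ Pᵢ` of `π`-reversible irreducible
kernels (`αᵢ > 0`, `Σ αᵢ = 1`, `f̄` centred and non-zero). -/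
theorem kernelMix_piInner_fundamental_le_harmonicMean [Nonempty ι] (hπ : ∀ x, 0 < π x)
    (hπ1 : ∑ x, π x = 1) {α : ι → ℝ} (hα : ∀ i, 0 < α i) (hα1 : ∑ i, α i = 1)
    {P : ι → Matrix X X ℝ} (hP : ∀ i, IsRowStochastic (P i)) (hDB : ∀ i, DetailedBalance π (P i))
    (hirr : ∀ i, Literature.Probability.MarkovChains.IsIrreducible (P i)) {g : X → ℝ}
    (hg : ∑ y, π y * g y = 0) (hg0 : 0 < piInner π g g) :
    piInner π g (fundamentalMatrix π (fun x y => ∑ i, α i * P i x y) *ᵥ g)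
      ≤ 1 / ∑ i, α i / piInner π g (fundamentalMatrix π (P i) *ᵥ g) := by
  obtain ⟨i₀⟩ := ‹Nonempty ι›
  have hPm := kernelMix_isRowStochastic (fun i => (hα i).le) hα1 hP
  have hDBm := kernelMix_detailedBalance (α := α) hDB
  have hirrm := kernelMix_isIrreducible (fun i => (hα i).le) hP (hα i₀) (hirr i₀)
  have hstm := hDBm.isStationary hPm.2
  have hKm := isUnit_fundamentalInv hπ1 hPm hstm hirrm
  set h := fundamentalMatrix π (fun x y => ∑ i, α i * P i x y) *ᵥ g with hh
  set b := piInner π g h with hb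
  set V : ι → ℝ := fun i => piInner π g (fundamentalMatrix π (P i) *ᵥ g) with hVdef
  have hVpos : ∀ i, 0 < V i := fun i => piInner_fundamental_pos hπ hπ1 (hP i) (hDB i) (hirr i) hg hg0
  -- each component's Dirichlet form of `h` is at least `b²/Vᵢ`
  have hEi : ∀ i, b ^ 2 / V i ≤ dirichletForm π (P i) h := fun i => by
    refine sq_div_le_of_variational (hVpos i) (dirichletForm_nonneg (fun x => (hπ x).le) (hP i).1 h)
      fun c => ?_
    have hv := variational_le hπ hπ1 (hP i) (hDB i)
      (isUnit_fundamentalInv hπ1 (hP i) ((hDB i).isStationary (hP i).2) (hirr i)) hg (c • h)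
    have e1 : piInner π g (c • h) = c * b := by
      rw [hb]
      unfold piInner
      rw [Finset.mul_sum]
      exact Finset.sum_congr rfl fun x _ => by simp [Pi.smul_apply, smul_eq_mul]; ring
    have e2 : dirichletForm π (P i) (c • h) = c ^ 2 * dirichletForm π (P i) h := by
      unfold dirichletForm
      rw [Finset.mul_sum, Finset.mul_sum, Finset.mul_sum]
      refine Finset.sum_congr rfl fun x _ => ?_
      rw [Finset.mul_sum, Finset.mul_sum, Finset.mul_sum]
      exact Finset.sum_congr rfl fun y _ => by simp [Pi.smul_apply, smul_eq_mul]; ring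
    rw [e1, e2] at hv
    linarith
  -- the mixture's optimum: `⟨g, Z_mix g⟩ = 2b − 𝓔_mix(h) = 2b − Σ αᵢ 𝓔ᵢ(h)`
  have hopt := variational_eq hπ1 hPm hstm hKm hg
  rw [← hh] at hopt
  set H := ∑ i, α i / V i with hH
  have hHpos : 0 < H := Finset.sum_pos (fun i _ => div_pos (hα i) (hVpos i)) Finset.univ_nonempty
  have hEmix : b ^ 2 * H ≤ dirichletForm π (fun x y => ∑ i, α i * P i x y) h := by
    rw [dirichletForm_kernelMix, hH, Finset.mul_sum]
    refine Finset.sum_le_sum fun i _ => ?_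
    calc b ^ 2 * (α i / V i) = α i * (b ^ 2 / V i) := by ring
      _ ≤ α i * dirichletForm π (P i) h := mul_le_mul_of_nonneg_left (hEi i) (hα i).le
  calc piInner π g h = 2 * b - dirichletForm π (fun x y => ∑ i, α i * P i x y) h := by rw [← hopt]
    _ ≤ 2 * b - b ^ 2 * H := by linarith
    _ ≤ 1 / H := two_mul_sub_sq_mul_le_inv hHpos

/-- **RANDOMLY ALTERNATING REVERSIBLE SAMPLERS IS NEVER WORSE THAN THE HARMONIC MEAN OF RUNNING EACH
ALONE.**  `π > 0` a probability vector, `P₁, …, P_N` row-stochastic, `π`-reversible, irreducible;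
`αᵢ > 0`, `Σ αᵢ = 1`; `f` with `var_π f = ‖f̄‖²_π > 0`.  Then
`v(f, π, Σ αᵢPᵢ) + ‖f̄‖²_π ≤ 1/Σᵢ αᵢ/(v(f, π, Pᵢ) + ‖f̄‖²_π)` — i.e. `τ_int` of the alternation is at most
the `α`-weighted harmonic mean of the components' `τ_int`. -/
theorem kernelMix_asympVar_le_harmonicMean [Nonempty ι] (hπ : ∀ x, 0 < π x) (hπ1 : ∑ x, π x = 1)
    {α : ι → ℝ} (hα : ∀ i, 0 < α i) (hα1 : ∑ i, α i = 1) {P : ι → Matrix X X ℝ}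
    (hP : ∀ i, IsRowStochastic (P i)) (hDB : ∀ i, DetailedBalance π (P i))
    (hirr : ∀ i, Literature.Probability.MarkovChains.IsIrreducible (P i)) (f : X → ℝ)
    (hf : 0 < piInner π (centred π f) (centred π f)) :
    asympVar f π (fun x y => ∑ i, α i * P i x y) + piInner π (centred π f) (centred π f)
      ≤ 1 / ∑ i, α i / (asympVar f π (P i) + piInner π (centred π f) (centred π f)) := by
  obtain ⟨i₀⟩ := ‹Nonempty ι›
  have hPm := kernelMix_isRowStochastic (fun i => (hα i).le) hα1 hP
  have hDBm := kernelMix_detailedBalance (α := α) hDB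
  have hirrm := kernelMix_isIrreducible (fun i => (hα i).le) hP (hα i₀) (hirr i₀)
  have hstm := hDBm.isStationary hPm.2
  have hKm := isUnit_fundamentalInv hπ1 hPm hstm hirrm
  have hg : ∑ y, π y * centred π f y = 0 := sum_mul_centred hπ1 f
  set g := centred π f with hgdef
  set V : ι → ℝ := fun i => piInner π g (fundamentalMatrix π (P i) *ᵥ g) with hVdef
  have hVpos : ∀ i, 0 < V i := fun i => piInner_fundamental_pos hπ hπ1 (hP i) (hDB i) (hirr i) hg hf
  -- `v + ‖ḡ‖² = 2V` for every kernel
  have hvm : asympVar f π (fun x y => ∑ i, α i * P i x y) + piInner π g g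
      = 2 * piInner π g (fundamentalMatrix π (fun x y => ∑ i, α i * P i x y) *ᵥ g) := by
    rw [asympVar_eq_centred hπ1 hPm hstm hKm f]
    ring
  have hvi : ∀ i, asympVar f π (P i) + piInner π g g = 2 * V i := fun i => by
    rw [asympVar_eq_centred hπ1 (hP i) ((hDB i).isStationary (hP i).2)
      (isUnit_fundamentalInv hπ1 (hP i) ((hDB i).isStationary (hP i).2) (hirr i)) f]
    ring
  have hmain := kernelMix_piInner_fundamental_le_harmonicMean hπ hπ1 hα hα1 hP hDB hirr hg hf
  rw [hvm]
  simp_rw [hvi]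
  have hH : 0 < ∑ i, α i / V i := Finset.sum_pos (fun i _ => div_pos (hα i) (hVpos i)) Finset.univ_nonempty
  have e : ∑ i, α i / (2 * V i) = (∑ i, α i / V i) / 2 := by
    rw [Finset.sum_div]
    exact Finset.sum_congr rfl fun i _ => by rw [div_div, mul_comm]
  rw [e, one_div_div]
  calc 2 * piInner π g (fundamentalMatrix π (fun x y => ∑ i, α i * P i x y) *ᵥ g)
      ≤ 2 * (1 / ∑ i, α i / V i) := by linarith
    _ = 2 / ∑ i, α i / V i := by ring

end Main

end Summit.Ventures.LatticeQCDFlow.Exactness
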